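import Literature.Claims.NS.Haitani2025
import Summits.NavierStokesRegularity.NavierStokesRegularity.Theorems.SoloRefuteHaitani2025Poincare1D
import HarnessLib

/-!
# SoloRefute — C133 `Haitani2025`, Lemma 8 (16) p.4 under the charitable weights (REF R#6): false for EVERY
# wavelet system of Definition 1 (dyadic Poincaré; part 2 of 2)

KILL (ADDENDUM-grade; locator of record (13) `Step1_Display13` and ADJUDICATED #115 untouched):
`not_Step4_retype_shiftWeight (B) : ¬ (REF R#6 re-typing, written inline)` — Lemma 8 (16) p.4 «‖u‖_{H¹(Ω)} ≤ C‖u‖_{W⁰_{2,log}}»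
re-typed with the weight `log(k+2)` in place of Definition 2's `log(k+1)` (REF R#6, RETYPE.md §2: «level 0 no
longer weightless»; the landed print-faithful face `not_Step4_Lemma8` p497521 uses `log 1 = 0` at level 0) is
STILL false for every `B`: for a single level-`k` element `u = ψ_{k,j}` (a finite wavelet sum),
`Σ_m log(m+2)·E_m(u) = log(k+2)·1` (orthonormality, Definition 1 item 3) while `‖u‖²_{L²} = 1` and
`‖∇u‖²_{L²(Ω)} ≥ 4^k` (dyadic Poincaré `four_pow_mul_l2Sq_le_gradL2Sq`: support in a cube of side `2^{-k}`,
item 1, class `C¹`), so (16) squared would give `1 + 4^k ≤ C² log(k+2) ≤ C²(k+1) ≤ C² 2^k`, false at any level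
with `2^k > C²`. Same witness: `not_Step4_retype_posLevels` — the printed weight `log(k+1)` restricted to sums
WITHOUT level-0 component (the other evident repair) fails too. Mechanism in one line: a weight `w_k` makes
`Σ_k w_k E_k` dominate the `H¹` norm of single wavelets only if `w_k ≳ 4^k` (inverse estimate (18) p.5 is an
upper bound, Poincaré the matching lower bound); `log` weights are off by an exponential.
Kernel lemmas (section `Wavelet` here; slab Poincaré in part 1 `SoloRefuteHaitani2025Poincare1D.lean`): ns-claims-typist-4 g3's records-only kit
`typist4-kit-PoincareCube.lean` a620f5152bf28770 (Fubini along `x₀` via `MeasureTheory.lmarginal` through the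
volume-preserving `WithLp.toLp`; set-integral bookkeeping on the open cube: the part of a closed dyadic cube
outside `Ω` lies on the null grid), proofs unchanged, adopted by the refuter of record ns-claims-refuter-3 g2;
section `ShiftWeight` by refuter-3 g2. Axioms: propext, Classical.choice, Quot.sound.
[cite: Haitani2025NavierStokesGitHub, Lemma 8 (16) p.4; Definition 1 p.2; Definition 2 (5) p.3]

WHAT THIS IS NOT: not a claim about NS regularity or blow-up; not a claim about any author beyond the typed
locator.
-/

set_option linter.dupNamespace false

noncomputable section

namespace Summit.NavierStokesRegularity.NavierStokesRegularity.Theorems.Haitani2025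

open Set MeasureTheory intervalIntegral Filter
open scoped ENNReal Topology
open Literature.Analysis.FluidPDE Literature.Claims.NS.Haitani2025 Literature.Claims.NS.Chio2026

/-! ## The dyadic-cube statement for Definition-1 wavelets -/

section Wavelet

/-- The open unit cube is open. [folklore] -/
private theorem isOpen_HOmega' : IsOpen HOmega := by
  have h : HOmega = ⋂ i : Fin 3, (fun x : E3 => x i) ⁻¹' Ioo (0 : ℝ) 1 := by
    ext x
    simp [HOmega]
  rw [h]
  exact isOpen_iInter_of_finite fun i =>
    isOpen_Ioo.preimage (EuclideanSpace.proj i : E3 →L[ℝ] ℝ).continuous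

/-- A coordinate hyperplane of `ℝ³` is Lebesgue-null. [folklore] -/
private theorem volume_hyperplane (i : Fin 3) (r : ℝ) : volume {x : E3 | x i = r} = 0 := by
  have hs : MeasurableSet {y : Fin 3 → ℝ | y i = r} :=
    measurableSet_eq_fun (measurable_pi_apply i) measurable_const
  have h1 : {x : E3 | x i = r} = WithLp.ofLp ⁻¹' {y : Fin 3 → ℝ | y i = r} := rfl
  rw [h1, (PiLp.volume_preserving_ofLp (Fin 3)).measure_preimage hs.nullMeasurableSet,
    MeasureTheory.volume_pi]
  exact Measure.pi_hyperplane (fun _ : Fin 3 => (volume : Measure ℝ)) i r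

/-- The boundary grid `⋃ᵢ {xᵢ = 0} ∪ {xᵢ = 1}` is null. [folklore] -/
private theorem volume_grid :
    volume (⋃ i : Fin 3, ({x : E3 | x i = 0} ∪ {x : E3 | x i = 1})) = 0 :=
  measure_iUnion_null_iff.mpr fun i => measure_union_null (volume_hyperplane i 0) (volume_hyperplane i 1)

/-- The dyadic cube of an index is compact. [folklore] -/
private theorem isCompact_cube (a : Idx) : IsCompact (cube a) := by
  have h : cube a = WithLp.ofLp ⁻¹' (Set.pi univ fun i : Fin 3 =>
      Icc (((a.2 i : ℕ) : ℝ) / 2 ^ a.1) ((((a.2 i : ℕ) : ℝ) + 1) / 2 ^ a.1)) := by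
    ext x
    simp [cube, Pi.le_def, forall_and]
  rw [h]
  exact ((PiLp.continuousLinearEquiv 2 ℝ (fun _ : Fin 3 => ℝ)).toHomeomorph.isCompact_preimage).mpr
    (isCompact_univ_pi fun i => isCompact_Icc)

/-- A point of a dyadic cube that is not in the open unit cube lies on the boundary grid.
[folklore] -/
private theorem mem_grid_of_mem_cube (a : Idx) {x : E3} (hx : x ∈ cube a) (hx' : x ∉ HOmega) :
    x ∈ ⋃ i : Fin 3, ({x : E3 | x i = 0} ∪ {x : E3 | x i = 1}) := by
  simp only [HOmega, mem_setOf_eq, not_forall, mem_Ioo, not_and_or, not_lt] at hx'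
  obtain ⟨i, hi⟩ := hx'
  have hlo : (0 : ℝ) ≤ ((a.2 i : ℕ) : ℝ) / 2 ^ a.1 := by positivity
  have hhi : (((a.2 i : ℕ) : ℝ) + 1) / 2 ^ a.1 ≤ 1 := by
    rw [div_le_one (by positivity)]
    have h := (a.2 i).isLt
    exact_mod_cast Nat.succ_le_of_lt h
  have hxi := hx i
  refine mem_iUnion.mpr ⟨i, ?_⟩
  rcases hi with hi | hi
  · left
    exact le_antisymm hi (hlo.trans hxi.1)
  · right
    exact le_antisymm (hxi.2.trans hhi) hi

/-- **Dyadic Poincaré for Definition-1 elements**: `4^k · ‖ψ_{k,j}‖²_{L²(Ω)} ≤ ‖∇ψ_{k,j}‖²_{L²(Ω)}` for every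
wavelet system of Definition 1 and every index (support in a cube of side `2^{−k}`, `C¹`; the open-cube
integrals of the skeleton). [cite: Haitani2025NavierStokesGitHub, Definition 1 items 1,4 p.2] -/
theorem four_pow_mul_l2Sq_le_gradL2Sq (B : WaveletSystem) (a : Idx) :
    (4 : ℝ) ^ a.1 * l2Sq (B.ψ a) ≤ gradL2Sq (B.ψ a) := by
  set ψ := B.ψ a with hψdef
  have hψ : ContDiff ℝ 1 ψ := B.contDiff a
  have hsupp : tsupport ψ ⊆ cube a := B.support a
  have hcontD : Continuous (fderiv ℝ ψ) := hψ.continuous_fderiv one_ne_zero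
  set k := a.1 with hk
  set h : ℝ := 1 / 2 ^ k with hhdef
  set c₀ : ℝ := ((a.2 0 : ℕ) : ℝ) / 2 ^ k with hc₀
  have hh : 0 ≤ h := by positivity
  have h2k : (0 : ℝ) < 2 ^ k := by positivity
  -- ψ vanishes off the slab `c₀ ≤ x₀ ≤ c₀ + h`
  have hzero : ∀ x : E3, x 0 ∉ Icc c₀ (c₀ + h) → ψ x = 0 := by
    intro x hx
    by_contra hne
    have hmem : x ∈ cube a := hsupp (subset_tsupport _ (Function.mem_support.mpr hne))
    have h0 := hmem 0
    apply hx
    refine ⟨h0.1, ?_⟩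
    have : c₀ + h = (((a.2 0 : ℕ) : ℝ) + 1) / 2 ^ k := by
      rw [hc₀, hhdef]
      field_simp
    rw [this]
    exact h0.2
  -- slab Poincaré
  have hslab := lintegral_sq_le_slab ψ hψ c₀ h hh hzero
  -- compact support, integrability
  have hcs : HasCompactSupport ψ :=
    IsCompact.of_isClosed_subset (isCompact_cube a) (isClosed_tsupport _) hsupp
  have hcs1 : HasCompactSupport fun x => ‖ψ x‖ ^ 2 := by
    refine HasCompactSupport.intro (isCompact_cube a) fun x hx => ?_
    have hx' : x ∉ tsupport ψ := fun h' => hx (hsupp h')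
    simp [image_eq_zero_of_notMem_tsupport hx']
  have hint1 : Integrable (fun x => ‖ψ x‖ ^ 2) :=
    (hψ.continuous.norm.pow 2).integrable_of_hasCompactSupport hcs1
  have hgradcont : Continuous fun x => gradSq ψ x := by
    show Continuous fun x => ∑ i, ‖(fderiv ℝ ψ x) ((stdOrthonormalBasis ℝ E3) i)‖ ^ 2
    exact continuous_finsetSum _ fun i _ => ((hcontD.clm_apply continuous_const).norm.pow 2)
  have hgradcs : HasCompactSupport fun x => gradSq ψ x := by
    refine HasCompactSupport.intro (isCompact_cube a) fun x hx => ?_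
    have hx' : x ∉ tsupport ψ := fun h' => hx (hsupp h')
    simp [Literature.Claims.NS.Chio2026.gradSq, frobeniusNormSq, fderiv_of_notMem_tsupport ℝ hx']
  have hint2 : Integrable (fun x => gradSq ψ x) := hgradcont.integrable_of_hasCompactSupport hgradcs
  -- LHS: ofReal (l2Sq ψ) ≤ ∫⁻ ofReal ‖ψ‖²
  have hL : ENNReal.ofReal (l2Sq ψ) ≤ ∫⁻ x, ENNReal.ofReal (‖ψ x‖ ^ 2) := by
    show ENNReal.ofReal (∫ x in HOmega, ‖ψ x‖ ^ 2) ≤ _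
    rw [MeasureTheory.ofReal_integral_eq_lintegral_ofReal hint1.integrableOn
      (Eventually.of_forall fun x => sq_nonneg _)]
    exact MeasureTheory.setLIntegral_le_lintegral _ _
  -- RHS: ∫⁻ ofReal ‖Dψ eX0‖² ≤ ofReal (gradL2Sq ψ)
  have hptw : ∀ x, ‖fderiv ℝ ψ x eX0‖ ^ 2 ≤ gradSq ψ x := by
    intro x
    show _ ≤ frobeniusNormSq (fderiv ℝ ψ x)
    rw [frobeniusNormSq_eq_sum (EuclideanSpace.basisFun (Fin 3) ℝ)]
    have he : eX0 = EuclideanSpace.basisFun (Fin 3) ℝ 0 := by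
      rw [EuclideanSpace.basisFun_apply]
      rfl
    rw [he]
    exact Finset.single_le_sum (f := fun i => ‖(fderiv ℝ ψ x) ((EuclideanSpace.basisFun (Fin 3) ℝ) i)‖ ^ 2)
      (fun i _ => sq_nonneg _) (Finset.mem_univ 0)
  have hnull : ∀ᵐ x ∂(volume : Measure E3), x ∈ HOmegaᶜ →
      ENNReal.ofReal (‖fderiv ℝ ψ x eX0‖ ^ 2) = 0 := by
    filter_upwards [measure_eq_zero_iff_ae_notMem.mp volume_grid] with x hx hxc
    have hxcube : x ∉ cube a := fun h' => hx (mem_grid_of_mem_cube a h' hxc)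
    have hx' : x ∉ tsupport ψ := fun h' => hxcube (hsupp h')
    simp [fderiv_of_notMem_tsupport ℝ hx']
  have hR : ∫⁻ x, ENNReal.ofReal (‖fderiv ℝ ψ x eX0‖ ^ 2) ≤ ENNReal.ofReal (gradL2Sq ψ) := by
    have hmeas : MeasurableSet HOmega := isOpen_HOmega'.measurableSet
    rw [← lintegral_add_compl (fun x => ENNReal.ofReal (‖fderiv ℝ ψ x eX0‖ ^ 2)) hmeas]
    have hz : ∫⁻ x in HOmegaᶜ, ENNReal.ofReal (‖fderiv ℝ ψ x eX0‖ ^ 2) = 0 := by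
      rw [lintegral_congr_ae ((ae_restrict_iff' hmeas.compl).mpr hnull), lintegral_zero]
    rw [hz, add_zero]
    show _ ≤ ENNReal.ofReal (∫ x in HOmega, gradSq ψ x)
    rw [MeasureTheory.ofReal_integral_eq_lintegral_ofReal hint2.integrableOn
      (Eventually.of_forall fun x => frobeniusNormSq_nonneg _)]
    exact lintegral_mono fun x => ENNReal.ofReal_le_ofReal (hptw x)
  -- assemble in ℝ≥0∞, then return to ℝ
  have hgradnn : 0 ≤ gradL2Sq ψ := integral_nonneg fun x => frobeniusNormSq_nonneg _
  have hchain : ENNReal.ofReal (l2Sq ψ) ≤ ENNReal.ofReal (h ^ 2 * gradL2Sq ψ) := by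
    rw [ENNReal.ofReal_mul (sq_nonneg _)]
    exact hL.trans (hslab.trans (by gcongr))
  have hreal : l2Sq ψ ≤ h ^ 2 * gradL2Sq ψ :=
    (ENNReal.ofReal_le_ofReal_iff (mul_nonneg (sq_nonneg _) hgradnn)).mp hchain
  have hh2 : (4 : ℝ) ^ k * h ^ 2 = 1 := by
    rw [hhdef]
    have : (4 : ℝ) ^ k = (2 ^ k) ^ 2 := by
      rw [← pow_mul, mul_comm, pow_mul]
      norm_num
    rw [this]
    field_simp
  calc (4 : ℝ) ^ k * l2Sq ψ ≤ (4 : ℝ) ^ k * (h ^ 2 * gradL2Sq ψ) := by gcongr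
    _ = ((4 : ℝ) ^ k * h ^ 2) * gradL2Sq ψ := by ring
    _ = gradL2Sq ψ := by rw [hh2, one_mul]

end Wavelet


/-! ## REF R#6 and the level-`≥ 1` reading: (16) is false for every `B` under both charitable weights
(re-typed statements written INLINE, as in `SoloRefuteHaitani2025Retypes.lean`; no new `Prop` definitions) -/

section ShiftWeight

open scoped InnerProductSpace

/-- Diagonal coefficient: `a_{k,j}(ψ_{k,j}) = ∫_Ω |ψ_{k,j}|² = 1` (Definition 1 item 3).
[cite: Haitani2025NavierStokesGitHub, Definition 1 item 3 p.2] -/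
theorem coeff_psi_self (B : WaveletSystem) (a : Idx) : coeff B (B.ψ a) a = 1 := by
  unfold coeff
  simp_rw [real_inner_self_eq_norm_sq]
  exact B.norm_one a

/-- Off-diagonal coefficients of a basis element vanish (Definition 1 item 3).
[cite: Haitani2025NavierStokesGitHub, Definition 1 item 3 p.2] -/
theorem coeff_psi_of_ne (B : WaveletSystem) {a b : Idx} (h : a ≠ b) : coeff B (B.ψ a) b = 0 :=
  B.orthogonal a b h

/-- The level energies of a single basis element: `E_m(ψ_{k,j}) = [m = k]`.
[cite: Haitani2025NavierStokesGitHub, Definition 4 (7) p.3] -/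
theorem levelEnergy_psi (B : WaveletSystem) (a : Idx) (m : ℕ) :
    levelEnergy B m (B.ψ a) = if m = a.1 then 1 else 0 := by
  obtain ⟨k, j₀⟩ := a
  unfold levelEnergy
  split_ifs with hm
  · subst hm
    rw [Finset.sum_eq_single j₀]
    · rw [coeff_psi_self]
      norm_num
    · intro j _ hj
      have hne : (⟨m, j₀⟩ : Idx) ≠ ⟨m, j⟩ := by
        intro h
        rw [Sigma.mk.inj_iff] at h
        exact hj (eq_of_heq h.2).symm
      rw [coeff_psi_of_ne B hne]
      norm_num
    · intro h
      exact absurd (Finset.mem_univ _) h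
  · refine Finset.sum_eq_zero fun j _ => ?_
    have hne : (⟨k, j₀⟩ : Idx) ≠ ⟨m, j⟩ := fun h => hm (congrArg Sigma.fst h).symm
    rw [coeff_psi_of_ne B hne]
    norm_num

/-- A weighted level sum of a single basis element picks out the weight of its level:
`Σ_m w_m E_m(ψ_{k,j}) = w_k` (any weight sequence `w`). [cite: Haitani2025NavierStokesGitHub, Definition 2 (5) p.3] -/
theorem tsum_weight_levelEnergy_psi (B : WaveletSystem) (w : ℕ → ℝ) (a : Idx) :
    ∑' m, w m * levelEnergy B m (B.ψ a) = w a.1 := by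
  simp_rw [levelEnergy_psi]
  rw [tsum_eq_single a.1 fun m hm => by rw [if_neg hm, mul_zero]]
  rw [if_pos rfl, mul_one]

/-- `‖ψ_{k,j}‖²_{L²} + ‖∇ψ_{k,j}‖²_{L²} ≥ 1 + 4^k` for every Definition-1 element (item 3 + dyadic Poincaré).
[cite: Haitani2025NavierStokesGitHub, Definition 1 p.2] -/
theorem one_add_four_pow_le_h1Sq (B : WaveletSystem) (a : Idx) :
    1 + (4 : ℝ) ^ a.1 ≤ l2Sq (B.ψ a) + gradL2Sq (B.ψ a) := by
  have hP := four_pow_mul_l2Sq_le_gradL2Sq B a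
  rw [B.norm_one, mul_one] at hP
  rw [B.norm_one]
  linarith

/-- Arithmetic of the witness level: if `C² < 2^k` then `C²·log(k+2) < 1 + 4^k`
(`log(k+2) ≤ k+1 ≤ 2^k` and `4^k = 2^k·2^k`). [folklore] -/
theorem sq_mul_log_lt_of_lt_two_pow {C : ℝ} {k : ℕ} (hk : C ^ 2 < (2 : ℝ) ^ k) :
    C ^ 2 * Real.log ((k : ℝ) + 2) < 1 + (4 : ℝ) ^ k := by
  have hlog : Real.log ((k : ℝ) + 2) ≤ (k : ℝ) + 1 := by
    have h := Real.log_le_sub_one_of_pos (by positivity : (0 : ℝ) < (k : ℝ) + 2)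
    linarith
  have hk2 : (k : ℝ) + 1 ≤ (2 : ℝ) ^ k := by
    exact_mod_cast Nat.succ_le_of_lt (Nat.lt_two_pow_self (n := k))
  have h4 : (4 : ℝ) ^ k = (2 : ℝ) ^ k * (2 : ℝ) ^ k := by
    rw [← mul_pow]
    norm_num
  have hC2 : 0 ≤ C ^ 2 := sq_nonneg C
  have h2k : (0 : ℝ) < (2 : ℝ) ^ k := by positivity
  calc C ^ 2 * Real.log ((k : ℝ) + 2) ≤ C ^ 2 * (2 : ℝ) ^ k :=
        mul_le_mul_of_nonneg_left (hlog.trans hk2) hC2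
    _ < (2 : ℝ) ^ k * (2 : ℝ) ^ k := mul_lt_mul_of_pos_right hk h2k
    _ = (4 : ℝ) ^ k := h4.symm
    _ < 1 + (4 : ℝ) ^ k := lt_one_add _

/-- **KILL (REF R#6 `Step4_shiftWeight`, for EVERY wavelet system of Definition 1).** Lemma 8 (16) p.4 typed exactly
as `Step4_Lemma8` (finite wavelet sums, squared form) but with the weight `log(k+2)` in place of Definition 2's
`log(k+1)` (RETYPE.md §2 R#6 «level 0 no longer weightless») is false: witness the finite wavelet sum `u = ψ_{k,0}`
at a level `k` with `2^k > C²` — `Σ_m log(m+2)E_m(u) = log(k+2)`, `‖u‖²_{L²} + ‖∇u‖²_{L²} ≥ 1 + 4^k > C² log(k+2)`.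
[cite: Haitani2025NavierStokesGitHub, Lemma 8 (16) p.4; Definition 2 (5) p.3]
[claim: Haitani2025NavierStokesGitHub, status: disputed] -/
theorem not_Step4_retype_shiftWeight (B : WaveletSystem) :
    ¬ (∃ C : ℝ, 0 < C ∧ ∀ (S : Finset Idx) (c : Idx → ℝ),
        l2Sq (fun x => ∑ a ∈ S, c a • B.ψ a x) + gradL2Sq (fun x => ∑ a ∈ S, c a • B.ψ a x) ≤
          C ^ 2 * ∑' k : ℕ, Real.log ((k : ℝ) + 2) * levelEnergy B k (fun x => ∑ a ∈ S, c a • B.ψ a x)) := by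
  rintro ⟨C, _, h⟩
  obtain ⟨k, hk⟩ := pow_unbounded_of_one_lt (C ^ 2) (one_lt_two : (1 : ℝ) < 2)
  let a : Idx := ⟨k, fun _ => ⟨0, Nat.two_pow_pos k⟩⟩
  have h1 := h {a} (fun _ => 1)
  have h2 : l2Sq (B.ψ a) + gradL2Sq (B.ψ a) ≤
      C ^ 2 * ∑' m : ℕ, Real.log ((m : ℝ) + 2) * levelEnergy B m (B.ψ a) := by
    simpa [Finset.sum_singleton] using h1
  have hw : ∑' m : ℕ, Real.log ((m : ℝ) + 2) * levelEnergy B m (B.ψ a) = Real.log ((k : ℝ) + 2) :=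
    tsum_weight_levelEnergy_psi B (fun m => Real.log ((m : ℝ) + 2)) a
  have hlow : 1 + (4 : ℝ) ^ k ≤ l2Sq (B.ψ a) + gradL2Sq (B.ψ a) := one_add_four_pow_le_h1Sq B a
  have hlt := sq_mul_log_lt_of_lt_two_pow hk
  rw [hw] at h2
  linarith

/-- **KILL (the level-`≥ 1` reading of (16), for EVERY wavelet system of Definition 1).** The printed weight
`log(k+1)` (`wlogSq`), the embedding asked only of finite wavelet sums with NO level-0 component (so that no term is
weightless — the other evident repair of the landed level-0 face `not_Step4_Lemma8`): false by the same witness at a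
level `k ≥ 1` with `2^k > C²`, since `log(k+1) ≤ log(k+2)`. [cite: Haitani2025NavierStokesGitHub, Lemma 8 (16) p.4]
[claim: Haitani2025NavierStokesGitHub, status: disputed] -/
theorem not_Step4_retype_posLevels (B : WaveletSystem) :
    ¬ (∃ C : ℝ, 0 < C ∧ ∀ (S : Finset Idx) (c : Idx → ℝ), (∀ a ∈ S, 1 ≤ a.1) →
        l2Sq (fun x => ∑ a ∈ S, c a • B.ψ a x) + gradL2Sq (fun x => ∑ a ∈ S, c a • B.ψ a x) ≤
          C ^ 2 * wlogSq B (fun x => ∑ a ∈ S, c a • B.ψ a x)) := by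
  rintro ⟨C, _, h⟩
  obtain ⟨k₀, hk₀⟩ := pow_unbounded_of_one_lt (C ^ 2) (one_lt_two : (1 : ℝ) < 2)
  have hk : C ^ 2 < (2 : ℝ) ^ (k₀ + 1) := hk₀.trans_le (pow_le_pow_right₀ one_le_two (Nat.le_succ k₀))
  let a : Idx := ⟨k₀ + 1, fun _ => ⟨0, Nat.two_pow_pos (k₀ + 1)⟩⟩
  have h1 := h {a} (fun _ => 1) (fun b hb => by
    rw [Finset.mem_singleton] at hb
    subst hb
    exact Nat.succ_le_succ (Nat.zero_le k₀))
  have h2 : l2Sq (B.ψ a) + gradL2Sq (B.ψ a) ≤ C ^ 2 * wlogSq B (B.ψ a) := by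
    simpa [Finset.sum_singleton] using h1
  have hw : wlogSq B (B.ψ a) = logW (k₀ + 1) := tsum_weight_levelEnergy_psi B logW a
  have hlow : 1 + (4 : ℝ) ^ (k₀ + 1) ≤ l2Sq (B.ψ a) + gradL2Sq (B.ψ a) := one_add_four_pow_le_h1Sq B a
  have hmono : logW (k₀ + 1) ≤ Real.log (((k₀ + 1 : ℕ) : ℝ) + 2) := by
    unfold logW
    exact Real.log_le_log (by positivity) (by linarith)
  have hlt := sq_mul_log_lt_of_lt_two_pow hk
  have h3 : C ^ 2 * logW (k₀ + 1) ≤ C ^ 2 * Real.log (((k₀ + 1 : ℕ) : ℝ) + 2) :=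
    mul_le_mul_of_nonneg_left hmono (sq_nonneg C)
  rw [hw] at h2
  linarith

end ShiftWeight

end Summit.NavierStokesRegularity.NavierStokesRegularity.Theorems.Haitani2025

end

-- WHAT THIS IS NOT: not a claim about NS regularity or blow-up; not a claim about any author beyond the typed
-- locator.
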